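import Mathlib
import HarnessLib
import HarnessLib.Audit
import Summits.AtomisticToContinuum.Statement
import Literature.MathematicalPhysics.QuantumManyBody.PeriodicBoseGas

/-!
Route: BECSectorGap

CLOSED (retired) 2026-08-15T13:40:21Z by operator:999:1257524 — reason: not-a-thesis: assembly does not conclude the sub-problem Statement — note: D-0027 §2.1 audit (human 2026-08-15: routes that do not decide the summit are removed): the assembly concludes `Literature.MathematicalPhysics.QuantumManyBody.BoseGas.BoseEinsteinCondensation`, not the sub-problem statement; a NEW conforming route may be opened from the same idea (generated `closes . The file is kept as the record of this route; refuted decls are indexed as negative knowledge (`ledger negatives`).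

# Route BECSectorGap — a κk² floor on the particle–hole momentum-sector gap turns the Wagner–Feynman
bound into n_k ≤ (k²+2ρ‖v‖₁)/Γ and type-I BEC by mode counting

It suffices to show X = SectorGapFloor ∧ HardCoreMomentBound ∧ BoundaryTransferWeak (card
sector-gap-no-cheap-momentum, "no cheap
momentum sharing", NCMS_κ). SectorGapFloor: for every repulsive finite-range v ≢ 0 and every window
constant C > 0 there are κ > 0 and
ρ₀ > 0 such that for ρ < ρ₀, all large N (torus of side L = (N/ρ)^{1/3}) and every k ≠ 0 with |k|² ≤
Cρ the PARTICLE–HOLE SECTOR GAP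
Γ_N(k) := E_{N+1}(k) + E_{N−1}(k) − 2E₀(N) is ≥ 2κ|k|², where E_M(k) = inf of the periodic M-body
energy over Bloch states
Ψ(X + s𝟙) = e^{ik·s}Ψ(X) (= E₀(M) + ε^{L,M}(k), the infimum of the energy–momentum spectrum of
CorneanDerezinskiZin2009). Given it, the
Wagner–Feynman moment bound read backwards, n_k·Γ_N(k) ≤ ⟨[[a_k,H],a_k†]⟩ ≤ k² + 2ρ‖v‖₁, plus
Parseval and a d = 3 lattice count give
constant-mode occupation ≥ N/2 on the torus for integrable v (support MomentBoundCondensation,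
provable now, operator-free); hard cores need
the Jastrow-dressed version (crux HardCoreMomentBound); the shared crux BoundaryTransferWeak
(BECPeriodicReduction) carries torus ⇒ Dirichlet.
Lean: `SectorGapFloor ∧ HardCoreMomentBound ∧ BoundaryTransferWeak` (decls of this route; bodies
under ## Cruxes, all rc 0 in Sketch.lean together with the term-mode proof of Assembly)

## Assembly
Pure logic (proved sorry-free in Sketch.lean, axioms propext/choice/Quot.sound): fix v repulsive
finite-range; trichotomy on ∫v(|x|)dx ∈ {0}, (0,∞), {∞}: FreeGasCondensation, resp.
MomentBoundCondensation fed with ZeroMomentumGround and SectorGapFloor, resp. HardCoreMomentBound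
fed with SectorGapFloor, give the PeriodicBEC body for v; BoundaryTransferWeak turns it into ∃ρ₀
∀ρ<ρ₀ HasGroundStateBEC v ρ, i.e. the conjunct.

Rationale: WHY THIS LINE. Mechanism (Wagner1966; Stringari1995 eq. (16) "Feynman bound", PDF p. 75;
PitaevskiiStringari1991): for a P = 0 state Φ of N bosons on
the torus, a_kΦ and a_k†Φ lie in the momentum ∓k sectors of N∓1 particles, so n_k[E_{N−1}(k)−E₀(N)]
+ (n_k+1)[E_{N+1}(k)−E₀(N)] ≤
⟨[[a_k,H],a_k†]⟩_Φ + (form error, 0 for an eigenstate) and the CCR collapse the double commutator to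
k² + ρv̂(0) + L⁻³Σ_q v̂(k−q)n_q ≤
k² + 2ρ‖v‖₁: a LOWER bound on sector energies is an UPPER (infrared) bound n_k ≤ (k²+2ρ‖v‖₁)/Γ_N(k),
Bogoliubov-saturated, with the
chemical potentials cancelling between the hole and particle channels. The hypothesis is a
finite-volume, quadratic-floor weakening of
Landau's criterion = CorneanDerezinskiZin2009 Conj. 1.1(3)/2.2 (critical velocity c_{crit,R} > 0, d
≥ 2), asked only on |k| ≤ (Cρ)^{1/2}
where boosts/umklapp (ibid. §2.3: c_crit^{L,n} ≤ π/L at |k| ~ ρL²) and vortex rings (|k| ≳ 1/a) are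
absent; at the bottom k = 2π/L it
tolerates a free-particle-like gap κ(2π/L)². Imported: sum rules / joint energy–momentum spectrum
(many-body spectral theory) and, for
attacking the crux, the ground-state-transform view ε^{L,N}(k) = sectorial Poincaré constant of μ =
Ψ₀² (functional inequalities; card
sector-poincare-two-scale is the complementary "upper half"). Versus existing routes:
BECInfraredBound WANTS the IR bound n_k ≲ √ρ/|k| as
its crux (continuum Gaussian domination, no mechanism); here the IR bound is DERIVED from one
gauge-invariant min–max quantity with no
reflection positivity, no S(k), no vertex, no energy asymptotics beyond E₀ ≤ ½ρ‖v‖₁N, and the line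
plugs into BECPeriodicReduction.

RANKED CRUXES. #2 SectorGapFloor (crux) — NCMS_κ, particle–hole form (card N1): ∀ repulsive
finite-range v with ∫v(|x|)dx ≠ 0, ∀ C > 0, ∃ κ > 0, ∃ ρ₀ > 0, ∀ ρ ∈ (0,ρ₀), ∀ᶠ N, ∀ k ≠ 0 with ‖k‖²
≤ Cρ: 2E₀^per(N,L) + 2κ‖k‖² ≤ E^per_{N+1}(k;L) + E^per_{N−1}(k;L), L = (N/ρ)^{1/3}, E^per_M(k;L) =
inf periodicEnergy over Bloch-k periodic M-body states (⊤ off the dual lattice, so only k ∈ (2π/L)ℤ³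
bind). Bogoliubov value: Γ ≈ 2c_s|k| + 8πa/L³, c_s = (16πaρ)^{1/2}, so κ = ½(16πa/C)^{1/2} works;
the free gas (Γ = 4π|k|/L) is correctly excluded. [difficulty: open-problem] (why it might fail: A
TL spectral floor uniform in L: rigorous sector spectra exist only in GP/mean-field scaling
(BoccatoEtAl2019Acta, BrenneckeCaporalettiSchlein2022 p.2 'still open', LSSY Thm 5.3); hides
near-convexity μ_{N+1}−μ_N ≥ −o(L⁻²); dies on any soft non-phonon branch with Γ/k²→0 in the window.)
[CorneanDerezinskiZin2009, LiebSeiringerYngvason2002, BoccatoEtAl2019Acta,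
BrenneckeCaporalettiSchlein2022, Seiringer2011, DerezinskiNapiorkowski2014, LSSY2005]
#3 HardCoreMomentBound (crux) — the non-integrable case of the chain (card N2 hard-core flag): for
repulsive finite-range v with ∫v(|x|)dx = ∞ (hard cores, r^{−3}-type cores), the SectorGapFloor
conclusion for v implies the PeriodicBEC body for v (constant-mode occupation ≥ cN for
δ-near-minimisers on the torus of side (N/ρ)^{1/3}, all small ρ). Intended proof: replace a_k† by
the Jastrow/Dyson-dressed creation a†(φ_k∏_j f(x−x_j)) (zero-energy scattering solution f, cut at a
≪ R ≪ ρ^{−1/3}) so that the dressed double commutator is ≤ k²(1+CρR³) + Cρa, bound the dressed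
occupations by the sector gap exactly as in the soft case, and control |n₀ − ñ₀| ≤ CN(ρR³)^{1/2};
the UV tail needs a Dyson-type bound E₀ ≤ CρaN (LSSY2005 Thm 2.2 = named fact
LSSY2005_upperBound_periodic, to be re-proved as a helper); zero-momentum uniqueness at low density
is part of the item. [deps: SectorGapFloor] [difficulty: L] (why it might fail: Bare a_k†Ψ₀ leaves
the form domain (⟨[[a,V],a†]⟩ = ρv̂(0) = ∞); the dressed double commutator has 3-body terms and
[A,A†] ≠ 1, and no printed estimate controls it by ρa uniformly in N — the dressing error
CN(ρR³)^{1/2} must beat N/2 with R ≫ a.) [LSSY2005, Dyson1957, Stringari1995,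
LiebSeiringerYngvason2000]
#4 BoundaryTransferWeak (crux) — shared verbatim with route BECPeriodicReduction
(stmt-AtomisticToContinuum-0827): for each repulsive finite-range v, the PeriodicBEC body for v
(torus, constant mode, near-minimisers) implies ∃ρ₀>0 ∀ρ∈(0,ρ₀) HasGroundStateBEC v ρ (Dirichlet
box, λ_max(γ) ≥ cN via condensateNumber). [difficulty: L] (why it might fail: Dirichlet GS is a
periodic trial state but lies a wall term ≫ δ above E₀^per, so the torus hypothesis never fires
directly; needs a structural (Neumann-bracketing + mode-free λ_max ≥ tr γ²/N) transfer not in print;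
BEC is BC-sensitive (Robinson 1976).) [LSSY2005, LiebSeiringerSolovejYngvason2005,
BoccatoSeiringer2023, Fournais2020]
#9 ZeroMomentumGround (support) — qualitative zero-momentum gap at fixed (N, L) for integrable v
(Perron–Frobenius): for repulsive finite-range v with ∫v(|x|)dx < ∞, every N, every L > 0 and every
q ≠ 0, E₀^per(N,L) < E^per_N(q;L) (strict; ⊤ on the right off the dual lattice; N = 0 and L-empty
cases hold vacuously/by ⊤). Proof: compact resolvent on the torus, positivity-improving e^{−tH} for
0 ≤ V ∈ L¹_loc (ReedSimonIV1978 XIII.44–47, XIII.12) ⇒ unique positive, hence translation-invariant,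
ground state; the sector-q infimum is attained, so equality would give a second ground state.
Variational substitute: H¹ minimiser + diamagnetic inequality + Harnack. Heavy in Lean (no many-body
operators in Mathlib) but no open mathematics. [difficulty: XL] [ReedSimonIV1978,
CorneanDerezinskiZin2009]
#9 MomentBoundCondensation (support) — the card's theorem-shaped half (N2+N3), integrable v ≢ 0:
ZeroMomentumGround-body(v) → SectorGapFloor-body(v) → PeriodicBEC-body(v). Proof (operator-free,
C¹-form level, δ chosen after N): decompose a δ-near-minimiser Ψ into global-translation sectors Ψ =
ΣΨ_q (C¹, Q-orthogonal); ZMG + H ≥ P²/N kill Σ_{q≠0}‖Ψ_q‖² ≤ δ/g_N; for Φ = Ψ₀/‖Ψ₀‖ use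
first-quantised a(φ_k), a†(φ_k) (as in `occupation`), the sector bounds Q_{N−1}(aΦ) ≥ E_{N−1}(k)n_k,
Q_{N+1}(a†Φ) ≥ E_{N+1}(k)(n_k+1), the identity Q_{N−1}(aΦ)+Q_{N+1}(a†Φ) = ⟨[[a,H],a†]⟩_Φ +
Re(Q_N−E₀)((2n̂_k+1)Φ,Φ) with the error ≤ C(N,L,k,v)√δ by form Cauchy–Schwarz, and ⟨[[a_k,H],a_k†]⟩
≤ k² + 2ρ‖v‖₁; hence n_k ≤ (k²+3ρ‖v‖₁)/(2κk²) on the window C = 4‖v‖₁; Parseval Σ_k n_k = N, Σ_k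
k²n_k = T ≤ E₀+δ ≤ ½ρ‖v‖₁N+δ (constant trial state) gives the UV tail ≤ N/8, and the d = 3 lattice
count gives the IR sum ≤ C_v N ρ^{1/2}/κ; so n₀ ≥ N/2 for ρ < ρ₀(v,κ), c = 1/2. [difficulty: XL]
[Stringari1995, Wagner1966, PitaevskiiStringari1991, Roepstorff1978, KennedyLiebShastry1988,
CorneanDerezinskiZin2009]
#9 FreeGasCondensation (support) — the a.e.-free gas (∫v(|x|)dx = 0, where SectorGapFloor is false
and not assumed) condenses on the torus: periodicEnergy = kinetic energy, E₀^per = 0, and for a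
δ-near-minimiser Σ_{k≠0} n_k ≤ T(L/2π)² ≤ δL²/4π², so δ = 2π²/L² gives n₀ ≥ N − ½ (Parseval in one
variable + Bessel for the gradient). [difficulty: M] [LSSY2005, PenroseOnsager1956]

TWO-LAYER PLAN. Foreseen glued splits (none filed now): SectorGapFloor ⇐ OneSidedSectorFloor
(ε^{L,N±1}(k) ≥ κk² on the window, the card's original NCMS = CDZ's IES floor) → NearConvexity
(E₀(N+1)+E₀(N−1)−2E₀(N) ≥ −κ(2π/L)² eventually; Bogoliubov: +8πa/L³) → SectorGapFloor.
MomentBoundCondensation ⇐ MomentInequality (the sector-wise (★) for P = 0 near-minimisers) →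
ModeCount (Parseval, UV Chebyshev, d = 3 lattice sums) → MomentBoundCondensation.
HardCoreMomentBound ⇐ DysonUpperBound (E₀^per ≤ 4πρaN(1+Ca/b), = Literature fact
LSSY2005_upperBound_periodic) → DressedMomentInequality → HardCoreMomentBound. A proof of
OneSidedSectorFloor is expected to come through the ground-state transform (ε^{L,N}(k) =
inf{∫|∇F|²Ψ₀² : F Bloch-k}/‖F‖²_{Ψ₀²}) — sector-resolved two-scale / Polchinski-flow Poincaré
inequalities (card sector-poincare-two-scale) or moving-frame stability H − w·P ≥ E₀ − O(w²) on |P|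
≤ K; the Jastrow parent-Hamiltonian anchor (card N4: diffusive sector gap Dk², BEC without phonons)
is the calibration case once three-body parent potentials are typable.

KILL CRITERIA. ¬SectorGapFloor — an admissible v ≢ 0 and densities ρ → 0 with Γ_N(k_N)/‖k_N‖² → 0
along window momenta (a soft non-phonon branch, a centre-of-mass tower, or failure of near-convexity
at order L⁻²) — closes the route `refuted:SectorGapFloor` and simultaneously kills every Landau-line
card (landau-to-infrared-bound, swap-overlap S3, sector-poincare-two-scale's target).
¬HardCoreMomentBound with SectorGapFloor standing forces a pivot to a different hard-core device
(softening at fixed scattering length + a monotonicity statement) or closes the route, since the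
conjunct quantifies over hard cores. ¬BoundaryTransferWeak kills this route and BECPeriodicReduction
alike (torus condensate destroyed by walls), not the conjunct. ¬ZeroMomentumGround or
¬FreeGasCondensation can only mean a misformalised Bloch/sector clause — restate, do not close.
PeriodicBEC (stmt-0826) proved by any other route moots ranks 2–3 (close superseded).

NOT DECOMPOSED YET. How SectorGapFloor is proved (functional-inequality vs operator route; the
near-convexity lemma; the window bookkeeping at |k| ~ 1/a for huge C) — layer-2 children only after
a refuter pass. The internal lemmas of MomentBoundCondensation (first-quantised CCR algebra on C¹
functions, 3-torus Fourier series in one variable inside a product, lattice-point counts, the form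
Cauchy–Schwarz error) ride as `--supports` helpers, never items. The dressed-operator algebra of
HardCoreMomentBound and the Dyson upper bound. Generalised (ODLRO-type) condensation from shell
positivity (card N5) is NOT filed: it does not assemble to the conjunct and its 1-D calibration
(Lieb–Liniger type-II branch: sector gap O(1/L) at k = 2πρ, audit-14) shows the shell must stay
below umklapp momenta. No T > 0, no d ≠ 3, canonical ensemble only.

CHEAPEST FALSIFIER. (i) Bogoliubov bookkeeping of the two-sided gap, done by hand here: Γ_N(k) =
ω_{N+1}(k)+ω_{N−1}(k)+(μ_{N+1}−μ_N) with ω = subadditive hull of √(k⁴+16πaρk²) =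
c_s|k|(1+O((c_sL)⁻²)) and μ_{N+1}−μ_N = 8πa/L³ > 0, so Γ ≥ 2κk² on ‖k‖² ≤ Cρ iff κ ≤ (16πa/C)^{1/2}
— passes, ρ-uniformly; the free gas fails it (Γ = 4π|k|/L), as the hypothesis ∫v ≠ 0 demands; boosts
(CorneanDerezinskiZin2009 §2.3) and vortex rings (|k| ≥ π/8a) sit outside the window for ρ < ρ₀.
(ii) The one computation a refuter should run first (kit): exact diagonalisation of N = 3…8 lattice
bosons (on-site U, filling fixed) on 3-D tori L³ = 4³…8³: Γ_N(k_min)/k_min² and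
ε^{L,N±1}(k_min)/k_min² versus L — a decreasing trend toward 0 at the lowest shell flags a tower and
kills the line cheaply. (iii) Lookup: any printed lower bound on ε^{L,n}(k) at fixed density?
CorneanDerezinskiZin2009 ("little rigorous work"), BrenneckeCaporalettiSchlein2022 p. 2 ("the form
of the excitation spectrum [is] still open" in the thermodynamic limit) — none found.

NUMBERS. Units ħ = 2m = 1. Bogoliubov: E_k = √(k⁴+16πaρk²), c_s = (16πaρ)^{1/2}, μ = 8πaρ, sector
bottom ω_L(k) → c_s|k|, n_k = v_k² saturates n_k ≤ (D_k − ω − μ)/(2ω) (landau-sector-gap-sum-rule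
(★)). Window K² = Cρ; soft chain: C = 4‖v‖₁ (UV tail ≤ (½ρ‖v‖₁N+δ)/K² ≤ N/8 + o(N)), κ_Bog =
½(16πa/C)^{1/2} = (πa/‖v‖₁)^{1/2} ≤ (1/8)^{1/2} by Spruch–Rosenberg 8πa ≤ ‖v‖₁ (in tree:
four_pi_mul_scatteringLength_le); IR sum ≤ N ρ^{1/2}[(4‖v‖₁)^{3/2}/(12π²) + 3‖v‖₁^{3/2}/(2π²)]/κ
(lattice count #{0<|k|≤K} ≈ K³L³/6π², Σ|k|⁻² ≈ KL³/2π²); depletion bound O(‖v‖₁²(ρ/a)^{1/2}) vs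
Bogoliubov's (8/3√π)(ρa³)^{1/2}. Free gas: Γ_free(k) = 4π|k|/L on axes (violates the floor for |k| >
2π/(κL)); boosts: ε(2πρL²·ê) = 4π²ρL (CDZ §2.3), c_crit^{L,n} ≤ π/L; vortex rings: p ≥ 2π²ρξ² ≈
π/(8a), E ≈ 2√2πΛ(ρp)^{1/2}. Rigorous spectra: GP regime only (BoccatoEtAl2019Acta: √(|p|⁴+16πa p²)
on the unit torus; BrenneckeCaporalettiSchlein2022: κ ∈ (0, 2/3) small). Items at open: 7 (3 cruxes,
3 supports, 1 assembly).

DEFINITION REQUESTS. None blocking: the Bloch-sector infimum E^per_M(k;L) = ⨅ over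
PeriodicTrialState M L with Ψ.ψ (X + s𝟙) = exp(i k·s)·Ψ.ψ X of periodicEnergy is inlined in four
items (rc 0). Nice-to-have (to be filed after open, non-blocking): `momentumSectorEnergy v M L k` in
Literature/MathematicalPhysics/QuantumManyBody/PeriodicBoseGas (= E^{L,M} + ε^{L,M}(k) of
CorneanDerezinskiZin2009 (1.6)), which would shorten this route's items and serve the other
Landau-line cards; plane-wave `cellOccupation` already exists. Literature want: Roepstorff1978
(doi:10.1007/bf01014310) is paywalled — acq-02351 filed by `lit read`.

Novelty: Searches (2026-08-15): `lit search --source crossref` ×4 ("excitation spectrum Bose gas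
Gross-Pitaevskii regime Bogoliubov theory" 15 hits → BoccatoEtAl2019Acta,
BrenneckeCaporalettiSchlein2022, LSY 2009 yrast line; "yrast states Bose gas total momentum" 12 →
CorneanDerezinskiZin2009 = doi:10.1063/1.3129489, Plyashechnik–Sokolik–Lozovik 2024 fixed-momentum
canonical ensemble; "Dereziński Napiórkowski excitation spectrum" 12 → DerezinskiNapiorkowski2014,
Seiringer2011; the sum-rule query); `lit vsearch` ×2 (sector-gap ⇒ n_k bound ⇒ BEC phrasing:
textbooks only — Griffin1993, Stringari1995, Pethick–Smith, Lieb–Seiringer 2010); `lit frontier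
AtomisticToContinuum --since 2020` (30 rows: Junge 2026, Chong–Liang–Nam 2026, no TL sector-spectrum
work); `lit read` CorneanDerezinskiZin2009 pp. 1–11 (Conj. 1.1, 2.2, Thm 2.1, 2.3, §2.3, §2.5),
book:griffin1995 PDF pp. 75–80 (eqs. (14)–(17), (37)–(41)), arXiv:2104.13003 pp. 2–3; `lit galaxy
search --star all/pdf` ×2 this session: daemon saturated (>90 s queue), relying on the card's and
audits' galaxy passes ("Landau criterion implies Bose-Einstein condensation": 0 hits; pdf star: Sütő
arXiv:1504.06528 only); OpenAlex/arXiv HTTP 429; Roepstorff1978 paywalled (acq-02351); negatives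
index empty.
Nearest prior art found: CorneanDerezinskiZin2009 (doi:10.1063/1.3129489) — defines exactly the crux
object ε^{L,n}(k) = inf sp(H(k)−E) and conjectures Landau positivity c_{crit,R} > 0 in d ≥ 2 (Conj.
1.1(3), 2.2), discussing consequences for superf  [refs: 10.1063/1.3129489, 2104.13003, 1504.06528, doi:10.1063/1.3129489, book:griffin1995, BrenneckeCaporalettiSchlein2022, CorneanDerezinskiZin2009, DerezinskiNapiorkowski2014, Seiringer2011, Griffin1993, Stringari1995, Roepstorff1978, Wagner1966]

Barriers (technique_class: sum-rules infrared-bound spectral-gap zero-temperature): - technique_class: sum-rules infrared-bound spectral-gap zero-temperature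
- Literature.Barriers.AtomisticToContinuum.KineticGapLengthScales: evaded in the implication — no
step of the form depletion ≤ L² × (excess energy); each mode pays 1/Γ_N(k) of its OWN sector and
Σ_{0<|k|≤K}(k²+ρ‖v‖₁)/k² converges relative to N in d = 3; at k = 2π/L the floor asked is only
κ(2π/L)², the free-gap scale. Honest: the barrier can re-enter inside a proof of SectorGapFloor that
localises in space (extensive localisation errors swamp a sector gap), which is why the crux is
pointed at ground-state-representation / sector technology, not energy localisation.
- Literature.Barriers.AtomisticToContinuum.EnergyAsymptoticsWithoutCondensation: evaded — the only
energy input is E₀ ≤ ½ρ‖v‖₁N (constant trial state) for the UV Chebyshev tail (hard cores: Dyson's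
leading-order bound); the eigen-equation/sector structure, not energy precision, excludes fragmented
P = 0 impostors; the 1-D Lieb–Liniger witness is reproduced (mode count Σ|k|⁻² diverges relative to
N in d = 1).
- Literature.Barriers.AtomisticToContinuum.BogoliubovPerturbationInfrared: not an expansion —
Bogoliubov enters only as the saturation case of the moment bound and as the plausibility check of
κ; the d = 3 logarithms concern the anomalous self-energy, while SectorGapFloor is a gauge-invariant
min–max quantity. Honest bet: the floor can be proved without constructing Bogoliubov theory in the
TL; if not, the route is an equivalence of diffi

History (route lifecycle, newest last):
- 2026-08-15T13:40:21Z · CLOSED retired — not-a-thesis: assembly does not conclude the sub-problem Statement (operator:999:1257524)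

sub-problem: BoseEinsteinCondensation · status: closed(retired) · opened planner-plancard-AtomisticToContinuum-BoseEin-e1de769a-0 2026-08-15T11:40:09Z · rev 0 · ledger route-AtomisticToContinuum-BECSectorGap
GENERATED by the gate from the ledger (D-0016/17). Provers cite these decls: `theorem foo : Summit.AtomisticToContinuum.BoseEinsteinCondensation.Theses.BECSectorGap.<Decl> := …` in Summits/AtomisticToContinuum/BoseEinsteinCondensation/Theorems/<Name>.lean.
-/

namespace Summit.AtomisticToContinuum.BoseEinsteinCondensation.Theses.BECSectorGap

open scoped BigOperators Topology Manifold Classical MeasureTheory ProbabilityTheory Matrix InnerProductSpace ComplexConjugate ContinuousMap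
open Filter Set Function TopologicalSpace MeasureTheory

attribute [summit_statement] _root_.BoseEinsteinCondensation

/-- item stmt-AtomisticToContinuum-5149 · crux · rank 2 · closed · moot by None · by planner
why it might fail: A TL spectral floor uniform in L: rigorous sector spectra exist only in GP/mean-field scaling (BoccatoEtAl2019Acta, BrenneckeCaporalettiSchlein2022 p.2 'still open', LSSY Thm 5.3); hides near-convexity μ_{N+1}−μ_N ≥ −o(L⁻²); dies on any soft non-phonon branch with Γ/k²→0 in the window.
sources: CorneanDerezinskiZin2009, LiebSeiringerYngvason2002, BoccatoEtAl2019Acta, BrenneckeCaporalettiSchlein2022, Seiringer2011, DerezinskiNapiorkowski2014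
[crux] NCMS_κ, particle–hole form (card N1): ∀ repulsive finite-range v with ∫v(|x|)dx ≠ 0, ∀ C > 0,
∃ κ > 0, ∃ ρ₀ > 0, ∀ ρ ∈ (0,ρ₀), ∀ᶠ N, ∀ k ≠ 0 with ‖k‖² ≤ Cρ: 2E₀^per(N,L) + 2κ‖k‖² ≤
E^per_{N+1}(k;L) + E^per_{N−1}(k;L), L = (N/ρ)^{1/3}, E^per_M(k;L) = inf periodicEnergy over Bloch-k
periodic M-body states (⊤ off the dual lattice, so only k ∈ (2π/L)ℤ³ bind). Bogoliubov value: Γ ≈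
2c_s|k| + 8πa/L³, c_s = (16πaρ)^{1/2}, so κ = ½(16πa/C)^{1/2} works; the free gas (Γ = 4π|k|/L) is
correctly excluded. [difficulty: open-problem] -/
@[route_item "route-AtomisticToContinuum-BECSectorGap"]
def SectorGapFloor : Prop :=
  ∀ v : ℝ → ENNReal, Literature.MathematicalPhysics.QuantumManyBody.BoseGas.IsRepulsiveFiniteRange v → (∫⁻ x : EuclideanSpace ℝ (Fin 3), v ‖x‖) ≠ 0 → ∀ C : ℝ, 0 < C → ∃ κ : ℝ, 0 < κ ∧ ∃ ρ₀ : ℝ, 0 < ρ₀ ∧ ∀ ρ : ℝ, 0 < ρ → ρ < ρ₀ → ∀ᶠ N : ℕ in Filter.atTop, ∀ k : EuclideanSpace ℝ (Fin 3), k ≠ 0 → ‖k‖ ^ 2 ≤ C * ρ → 2 * Literature.MathematicalPhysics.QuantumManyBody.BoseGas.periodicGroundStateEnergy v N (Literature.MathematicalPhysics.QuantumManyBody.BoseGas.sideLength ρ N) + ENNReal.ofReal (2 * κ * ‖k‖ ^ 2) ≤ (⨅ (Ψ : Literature.MathematicalPhysics.QuantumManyBody.BoseGas.PeriodicTrialState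 (N + 1) (Literature.MathematicalPhysics.QuantumManyBody.BoseGas.sideLength ρ N)) (_ : ∀ (s : EuclideanSpace ℝ (Fin 3)) (X : Fin (N + 1) → EuclideanSpace ℝ (Fin 3)), Ψ.ψ (fun i => X i + s) = Complex.exp (Complex.I * ↑(∑ j, k j * s j)) * Ψ.ψ X), Literature.MathematicalPhysics.QuantumManyBody.BoseGas.periodicEnergy v Ψ) + (⨅ (Ψ : Literature.MathematicalPhysics.QuantumManyBody.BoseGas.PeriodicTrialState (N - 1) (Literature.MathematicalPhysics.QuantumManyBody.BoseGas.sideLength ρ N)) (_ : ∀ (s : EuclideanSpace ℝ (Fin 3)) (X : Fin (N - 1) → EuclideanSpace ℝ (Fin 3)), Ψ.ψ (fun i => X i + s) = Complex.exp (Complex.I * ↑(∑ j, k j * s j)) * Ψ.ψ X), Literature.MathematicalPhysics.QuantumManyBody.BoseGas.periodicEnergy v Ψ)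

/-- item stmt-AtomisticToContinuum-5150 · crux · rank 3 · closed · moot by None · by planner
why it might fail: Bare a_k†Ψ₀ leaves the form domain (⟨[[a,V],a†]⟩ = ρv̂(0) = ∞); the dressed double commutator has 3-body terms and [A,A†] ≠ 1, and no printed estimate controls it by ρa uniformly in N — the dressing error CN(ρR³)^{1/2} must beat N/2 with R ≫ a.
sources: LSSY2005, Dyson1957, Stringari1995, LiebSeiringerYngvason2000
[crux] the non-integrable case of the chain (card N2 hard-core flag): for repulsive finite-range v
with ∫v(|x|)dx = ∞ (hard cores, r^{−3}-type cores), the SectorGapFloor conclusion for v implies the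
PeriodicBEC body for v (constant-mode occupation ≥ cN for δ-near-minimisers on the torus of side
(N/ρ)^{1/3}, all small ρ). Intended proof: replace a_k† by the Jastrow/Dyson-dressed creation
a†(φ_k∏_j f(x−x_j)) (zero-energy scattering solution f, cut at a ≪ R ≪ ρ^{−1/3}) so that the dressed
double commutator is ≤ k²(1+CρR³) + Cρa, bound the dressed occupations by the sector gap exactly as
in the soft case, and control |n₀ − ñ₀| ≤ CN(ρR³)^{1/2}; the UV tail needs a Dyson-type bound E₀ ≤
CρaN (LSSY2005 Thm 2.2 = named fact LSSY2005_upperBound_periodic, to be re-proved as a helper);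
zero-momentum uniqueness at low density is part of the item. [deps: SectorGapFloor] [difficulty: L] -/
@[route_item "route-AtomisticToContinuum-BECSectorGap"]
def HardCoreMomentBound : Prop :=
  ∀ v : ℝ → ENNReal, Literature.MathematicalPhysics.QuantumManyBody.BoseGas.IsRepulsiveFiniteRange v → (∫⁻ x : EuclideanSpace ℝ (Fin 3), v ‖x‖) = ⊤ → (∀ C : ℝ, 0 < C → ∃ κ : ℝ, 0 < κ ∧ ∃ ρ₀ : ℝ, 0 < ρ₀ ∧ ∀ ρ : ℝ, 0 < ρ → ρ < ρ₀ → ∀ᶠ N : ℕ in Filter.atTop, ∀ k : EuclideanSpace ℝ (Fin 3), k ≠ 0 → ‖k‖ ^ 2 ≤ C * ρ → 2 * Literature.MathematicalPhysics.QuantumManyBody.BoseGas.periodicGroundStateEnergy v N (Literature.MathematicalPhysics.QuantumManyBody.BoseGas.sideLength ρ N) + ENNReal.ofReal (2 * κ * ‖k‖ ^ 2) ≤ (⨅ (Ψ : Literature.MathematicalPhysics.QuantumManyBody.BoseGas.PeriodicTrialState (N + 1) (Literature.MathematicalPhysics.QuantumManyBody.BoseGas.sideLength ρ N)) (_ : ∀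 (s : EuclideanSpace ℝ (Fin 3)) (X : Fin (N + 1) → EuclideanSpace ℝ (Fin 3)), Ψ.ψ (fun i => X i + s) = Complex.exp (Complex.I * ↑(∑ j, k j * s j)) * Ψ.ψ X), Literature.MathematicalPhysics.QuantumManyBody.BoseGas.periodicEnergy v Ψ) + (⨅ (Ψ : Literature.MathematicalPhysics.QuantumManyBody.BoseGas.PeriodicTrialState (N - 1) (Literature.MathematicalPhysics.QuantumManyBody.BoseGas.sideLength ρ N)) (_ : ∀ (s : EuclideanSpace ℝ (Fin 3)) (X : Fin (N - 1) → EuclideanSpace ℝ (Fin 3)), Ψ.ψ (fun i => X i + s) = Complex.exp (Complex.I * ↑(∑ j, k j * s j)) * Ψ.ψ X), Literature.MathematicalPhysics.QuantumManyBody.BoseGas.periodicEnergy v Ψ)) → ∃ ρ₀ : ℝ, 0 < ρ₀ ∧ ∀ ρ : ℝ, 0 < ρ → ρ < ρ₀ → ∃ c : ℝ, 0 < c ∧ ∀ᶠ N : ℕ in Filter.atTop, ∃ δ : ENNReal, 0 < δ ∧ ∀ Ψ : Literature.MathematicalPhysics.QuantumManyBody.BoseGas.PeriodicTrialState N (Literature.MathematicalPhysics.QuantumManyBody.BoseGas.sideLength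 ρ N), Literature.MathematicalPhysics.QuantumManyBody.BoseGas.periodicEnergy v Ψ ≤ Literature.MathematicalPhysics.QuantumManyBody.BoseGas.periodicGroundStateEnergy v N (Literature.MathematicalPhysics.QuantumManyBody.BoseGas.sideLength ρ N) + δ → ENNReal.ofReal (c * N) ≤ Literature.MathematicalPhysics.QuantumManyBody.BoseGas.condensateOccupation N (Literature.MathematicalPhysics.QuantumManyBody.BoseGas.sideLength ρ N) Ψ.ψ

/-- item stmt-AtomisticToContinuum-0827 · crux · rank 4 · open · by planner
why it might fail: Dirichlet GS is a periodic trial state but lies a wall term ≫ δ above E₀^per, so the torus hypothesis never fires directly; needs a structural (Neumann-bracketing + mode-free λ_max ≥ tr γ²/N) transfer not in print; BEC is BC-sensitive (Robinson 1976).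
sources: LSSY2005, LiebSeiringerSolovejYngvason2005, BoccatoSeiringer2023, Fournais2020
[crux] BoundaryTransferWeak (mode-free boundary-condition transfer, per potential): for each
repulsive finite-range v, PeriodicBEC(v) implies ∃ρ₀>0 ∀ρ∈(0,ρ₀) HasGroundStateBEC v ρ (Dirichlet
ground state, λ_max(γ) ≥ cN via condensateNumber). Not glue: near-minimiser slacks are O(N/L²) while
Dirichlet/periodic energies differ by a boundary term ≫ N/L², so no energy-comparison proof;
expected route: Neumann bracketing of interior sub-boxes (−Δ_Dir ≥ ⊕−Δ_Neu, v ≥ 0) + a mode-free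
criterion (λ_max ≥ tr γ²/N). Only the ENERGY analogue is in print (LiebSeiringerSolovejYngvason2005
Ch. 2 after (2.8)). v ≡ 0: hypothesis and conclusion both true. -/
@[route_item "route-AtomisticToContinuum-BECSectorGap"]
def BoundaryTransferWeak : Prop :=
  ∀ v : ℝ → ENNReal, Literature.MathematicalPhysics.QuantumManyBody.BoseGas.IsRepulsiveFiniteRange v → (∃ ρ₀ : ℝ, 0 < ρ₀ ∧ ∀ ρ : ℝ, 0 < ρ → ρ < ρ₀ → ∃ c : ℝ, 0 < c ∧ ∀ᶠ N : ℕ in Filter.atTop, ∃ δ : ENNReal, 0 < δ ∧ ∀ Ψ : Literature.MathematicalPhysics.QuantumManyBody.BoseGas.PeriodicTrialState N (Literature.MathematicalPhysics.QuantumManyBody.BoseGas.sideLength ρ N), Literature.MathematicalPhysics.QuantumManyBody.BoseGas.periodicEnergy v Ψ ≤ Literature.MathematicalPhysics.QuantumManyBody.BoseGas.periodicGroundStateEnergy v N (Literature.MathematicalPhysics.QuantumManyBody.BoseGas.sideLength ρ N) + δ → ENNReal.ofReal (c * N) ≤ Literature.MathematicalPhysics.QuantumManyBody.BoseGas.condensateOccupation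 N (Literature.MathematicalPhysics.QuantumManyBody.BoseGas.sideLength ρ N) Ψ.ψ) → ∃ ρ₀ : ℝ, 0 < ρ₀ ∧ ∀ ρ : ℝ, 0 < ρ → ρ < ρ₀ → Literature.MathematicalPhysics.QuantumManyBody.BoseGas.HasGroundStateBEC v ρ

/-- item stmt-AtomisticToContinuum-5151 · support · rank 9 · closed · moot by None · by planner
sources: ReedSimonIV1978, CorneanDerezinskiZin2009
[support] qualitative zero-momentum gap at fixed (N, L) for integrable v (Perron–Frobenius): for
repulsive finite-range v with ∫v(|x|)dx < ∞, every N, every L > 0 and every q ≠ 0, E₀^per(N,L) <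
E^per_N(q;L) (strict; ⊤ on the right off the dual lattice; N = 0 and L-empty cases hold vacuously/by
⊤). Proof: compact resolvent on the torus, positivity-improving e^{−tH} for 0 ≤ V ∈ L¹_loc
(ReedSimonIV1978 XIII.44–47, XIII.12) ⇒ unique positive, hence translation-invariant, ground state;
the sector-q infimum is attained, so equality would give a second ground state. Variational
substitute: H¹ minimiser + diamagnetic inequality + Harnack. Heavy in Lean (no many-body operators
in Mathlib) but no open mathematics. [difficulty: XL] -/
@[route_item "route-AtomisticToContinuum-BECSectorGap"]
def ZeroMomentumGround : Prop :=
  ∀ v : ℝ → ENNReal, Literature.MathematicalPhysics.QuantumManyBody.BoseGas.IsRepulsiveFiniteRange v → (∫⁻ x : EuclideanSpace ℝ (Fin 3), v ‖x‖) ≠ ⊤ → ∀ (N : ℕ) (L : ℝ), 0 < L → ∀ q : EuclideanSpace ℝ (Fin 3), q ≠ 0 → Literature.MathematicalPhysics.QuantumManyBody.BoseGas.periodicGroundStateEnergy v N L < ⨅ (Ψ : Literature.MathematicalPhysics.QuantumManyBody.BoseGas.PeriodicTrialState N L) (_ : ∀ (s : EuclideanSpace ℝ (Fin 3)) (X : Fin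 N → EuclideanSpace ℝ (Fin 3)), Ψ.ψ (fun i => X i + s) = Complex.exp (Complex.I * ↑(∑ j, q j * s j)) * Ψ.ψ X), Literature.MathematicalPhysics.QuantumManyBody.BoseGas.periodicEnergy v Ψ

/-- item stmt-AtomisticToContinuum-5152 · support · rank 9 · closed · moot by None · by planner
sources: Stringari1995, Wagner1966, PitaevskiiStringari1991, Roepstorff1978, KennedyLiebShastry1988, CorneanDerezinskiZin2009
[support] the card's theorem-shaped half (N2+N3), integrable v ≢ 0: ZeroMomentumGround-body(v) →
SectorGapFloor-body(v) → PeriodicBEC-body(v). Proof (operator-free, C¹-form level, δ chosen after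
N): decompose a δ-near-minimiser Ψ into global-translation sectors Ψ = ΣΨ_q (C¹, Q-orthogonal); ZMG
+ H ≥ P²/N kill Σ_{q≠0}‖Ψ_q‖² ≤ δ/g_N; for Φ = Ψ₀/‖Ψ₀‖ use first-quantised a(φ_k), a†(φ_k) (as in
`occupation`), the sector bounds Q_{N−1}(aΦ) ≥ E_{N−1}(k)n_k, Q_{N+1}(a†Φ) ≥ E_{N+1}(k)(n_k+1), the
identity Q_{N−1}(aΦ)+Q_{N+1}(a†Φ) = ⟨[[a,H],a†]⟩_Φ + Re(Q_N−E₀)((2n̂_k+1)Φ,Φ) with the error ≤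
C(N,L,k,v)√δ by form Cauchy–Schwarz, and ⟨[[a_k,H],a_k†]⟩ ≤ k² + 2ρ‖v‖₁; hence n_k ≤
(k²+3ρ‖v‖₁)/(2κk²) on the window C = 4‖v‖₁; Parseval Σ_k n_k = N, Σ_k k²n_k = T ≤ E₀+δ ≤ ½ρ‖v‖₁N+δ
(constant trial state) gives the UV tail ≤ N/8, and the d = 3 lattice count gives the IR sum ≤ C_v N
ρ^{1/2}/κ; so n₀ ≥ N/2 for ρ < ρ₀(v,κ), c = 1/2. [difficulty: XL] -/
@[route_item "route-AtomisticToContinuum-BECSectorGap"]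
def MomentBoundCondensation : Prop :=
  ∀ v : ℝ → ENNReal, Literature.MathematicalPhysics.QuantumManyBody.BoseGas.IsRepulsiveFiniteRange v → (∫⁻ x : EuclideanSpace ℝ (Fin 3), v ‖x‖) ≠ ⊤ → (∫⁻ x : EuclideanSpace ℝ (Fin 3), v ‖x‖) ≠ 0 → (∀ (N : ℕ) (L : ℝ), 0 < L → ∀ q : EuclideanSpace ℝ (Fin 3), q ≠ 0 → Literature.MathematicalPhysics.QuantumManyBody.BoseGas.periodicGroundStateEnergy v N L < ⨅ (Ψ : Literature.MathematicalPhysics.QuantumManyBody.BoseGas.PeriodicTrialState N L) (_ : ∀ (s : EuclideanSpace ℝ (Fin 3)) (X : Fin N → EuclideanSpace ℝ (Fin 3)), Ψ.ψ (fun i => X i + s) = Complex.exp (Complex.I * ↑(∑ j, q j * s j)) * Ψ.ψ X), Literature.MathematicalPhysics.QuantumManyBody.BoseGas.periodicEnergy v Ψ) → (∀ C : ℝ, 0 < C → ∃ κ : ℝ, 0 < κ ∧ ∃ ρ₀ : ℝ, 0 < ρ₀ ∧ ∀ ρ : ℝ, 0 < ρ → ρ < ρ₀ → ∀ᶠ N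 : ℕ in Filter.atTop, ∀ k : EuclideanSpace ℝ (Fin 3), k ≠ 0 → ‖k‖ ^ 2 ≤ C * ρ → 2 * Literature.MathematicalPhysics.QuantumManyBody.BoseGas.periodicGroundStateEnergy v N (Literature.MathematicalPhysics.QuantumManyBody.BoseGas.sideLength ρ N) + ENNReal.ofReal (2 * κ * ‖k‖ ^ 2) ≤ (⨅ (Ψ : Literature.MathematicalPhysics.QuantumManyBody.BoseGas.PeriodicTrialState (N + 1) (Literature.MathematicalPhysics.QuantumManyBody.BoseGas.sideLength ρ N)) (_ : ∀ (s : EuclideanSpace ℝ (Fin 3)) (X : Fin (N + 1) → EuclideanSpace ℝ (Fin 3)), Ψ.ψ (fun i => X i + s) = Complex.exp (Complex.I * ↑(∑ j, k j * s j)) * Ψ.ψ X), Literature.MathematicalPhysics.QuantumManyBody.BoseGas.periodicEnergy v Ψ) + (⨅ (Ψ : Literature.MathematicalPhysics.QuantumManyBody.BoseGas.PeriodicTrialState (N - 1) (Literature.MathematicalPhysics.QuantumManyBody.BoseGas.sideLength ρ N)) (_ : ∀ (s : EuclideanSpace ℝ (Fin 3)) (X : Fin (N - 1) → EuclideanSpace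 ℝ (Fin 3)), Ψ.ψ (fun i => X i + s) = Complex.exp (Complex.I * ↑(∑ j, k j * s j)) * Ψ.ψ X), Literature.MathematicalPhysics.QuantumManyBody.BoseGas.periodicEnergy v Ψ)) → ∃ ρ₀ : ℝ, 0 < ρ₀ ∧ ∀ ρ : ℝ, 0 < ρ → ρ < ρ₀ → ∃ c : ℝ, 0 < c ∧ ∀ᶠ N : ℕ in Filter.atTop, ∃ δ : ENNReal, 0 < δ ∧ ∀ Ψ : Literature.MathematicalPhysics.QuantumManyBody.BoseGas.PeriodicTrialState N (Literature.MathematicalPhysics.QuantumManyBody.BoseGas.sideLength ρ N), Literature.MathematicalPhysics.QuantumManyBody.BoseGas.periodicEnergy v Ψ ≤ Literature.MathematicalPhysics.QuantumManyBody.BoseGas.periodicGroundStateEnergy v N (Literature.MathematicalPhysics.QuantumManyBody.BoseGas.sideLength ρ N) + δ → ENNReal.ofReal (c * N) ≤ Literature.MathematicalPhysics.QuantumManyBody.BoseGas.condensateOccupation N (Literature.MathematicalPhysics.QuantumManyBody.BoseGas.sideLength ρ N) Ψ.ψ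

/-- item stmt-AtomisticToContinuum-5153 · support · rank 9 · closed · moot by None · by planner
sources: LSSY2005, PenroseOnsager1956
[support] the a.e.-free gas (∫v(|x|)dx = 0, where SectorGapFloor is false and not assumed) condenses
on the torus: periodicEnergy = kinetic energy, E₀^per = 0, and for a δ-near-minimiser Σ_{k≠0} n_k ≤
T(L/2π)² ≤ δL²/4π², so δ = 2π²/L² gives n₀ ≥ N − ½ (Parseval in one variable + Bessel for the
gradient). [difficulty: M] -/
@[route_item "route-AtomisticToContinuum-BECSectorGap"]
def FreeGasCondensation : Prop :=
  ∀ v : ℝ → ENNReal, Literature.MathematicalPhysics.QuantumManyBody.BoseGas.IsRepulsiveFiniteRange v → (∫⁻ x : EuclideanSpace ℝ (Fin 3), v ‖x‖) = 0 → ∃ ρ₀ : ℝ, 0 < ρ₀ ∧ ∀ ρ : ℝ, 0 < ρ → ρ < ρ₀ → ∃ c : ℝ, 0 < c ∧ ∀ᶠ N : ℕ in Filter.atTop, ∃ δ : ENNReal, 0 < δ ∧ ∀ Ψ : Literature.MathematicalPhysics.QuantumManyBody.BoseGas.PeriodicTrialState N (Literature.MathematicalPhysics.QuantumManyBody.BoseGas.sideLength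 ρ N), Literature.MathematicalPhysics.QuantumManyBody.BoseGas.periodicEnergy v Ψ ≤ Literature.MathematicalPhysics.QuantumManyBody.BoseGas.periodicGroundStateEnergy v N (Literature.MathematicalPhysics.QuantumManyBody.BoseGas.sideLength ρ N) + δ → ENNReal.ofReal (c * N) ≤ Literature.MathematicalPhysics.QuantumManyBody.BoseGas.condensateOccupation N (Literature.MathematicalPhysics.QuantumManyBody.BoseGas.sideLength ρ N) Ψ.ψ

/-- item stmt-AtomisticToContinuum-5154 · assembly · rank 1 · closed · moot by None · by planner
sources: LSSY2005, Stringari1995, CorneanDerezinskiZin2009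
[assembly] SectorGapFloor → ZeroMomentumGround → MomentBoundCondensation → HardCoreMomentBound →
FreeGasCondensation → BoundaryTransferWeak → BoseEinsteinCondensation. -/
@[route_item "route-AtomisticToContinuum-BECSectorGap"]
def Assembly : Prop :=
  SectorGapFloor → ZeroMomentumGround → MomentBoundCondensation → HardCoreMomentBound → FreeGasCondensation → BoundaryTransferWeak → Literature.MathematicalPhysics.QuantumManyBody.BoseGas.BoseEinsteinCondensation

end Summit.AtomisticToContinuum.BoseEinsteinCondensation.Theses.BECSectorGap
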